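import Summits.RiemannHypothesis.RiemannHypothesis.Theorems.JensenLogBandArcModelCompare
import HarnessLib

/-!
# Main term versus translated-saddle model, III: the numeric form `ε = 1/100` ([CMP], near zone)

RH ladder column JENSEN, rung J-P(P3) «log band», BAND crux `XiDerivBandRealAllRates`
(stmt-RiemannHypothesis-19913) of route «JensenLogBand», line «band-one-window» (top-shell reshape,
BAND lead rh-jensen-prover g8). RH-FREE real arithmetic on top of `norm_arcMainTerm_sub_arcShiftModel_le`.
WHAT THIS IS NOT: nothing here bears on zeros of `ζ` off the line or the truth of RH.

* `cmp_product_le` — the product bound is `≤ 1/100` in regime R2 under `R ≤ 1/20`, `δ ≤ 32`,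
  `|T − T₀| ≤ R` and the largeness hypothesis `10⁴·N² ≤ δ·T₀` (each factor is within `4·10⁻³` of `1`);
* `abs_bandRadius_sub_le` — `|h(n,T) − h(n,T₀)| ≤ h(n,T)/20` when `|T − T₀| ≤ 1/20` (so the radius
  closeness hypothesis of [DISP]/[CMP] is automatic on discs of radius `≤ 1/20`);
* **`norm_arcMainTerm_sub_arcShiftModel_le_of_large`** — [CMP] with `ε = 1/100`:
  `‖Main(c,u*) − M̃_{c₀,u₀}(c)‖ ≤ (1/100)·‖M̃_{c₀,u₀}(c)‖` for two R2 centres with `‖c − c₀‖ ≤ R ≤ 1/20`,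
  base window `1 + δ + 2R ≤ Re(½+u₀)` and `10⁴·n² ≤ δ·T₀` — the `εc`-input of the near-zone disc lemma
  (theory g12 NOTE #4 §7 (B)/(C), interface `NearModelCompare … (εc = 1/100)` pointwise).

(prover-rh-jensen-eng-2-g7-0, 2026-08-27.)
-/

noncomputable section

-- single-problem summit: `Summit.RiemannHypothesis.RiemannHypothesis.…` is the tree convention
set_option linter.dupNamespace false

open Complex Real Set Metric
open scoped Interval

namespace Summit.RiemannHypothesis.RiemannHypothesis.Theorems.JensenPolynomials.LogBandArc

open Literature.NumberTheory.LFunctions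

/-! ## Numeric corollary: `ε = 1/100` under `10⁴·n² ≤ δ·T₀` -/

section numeric

/-- `x·e^x ≤ 3x` for `0 ≤ x ≤ 1`. [folklore] -/
theorem mul_exp_le_three_mul {x : ℝ} (h0 : 0 ≤ x) (h1 : x ≤ 1) : x * Real.exp x ≤ 3 * x := by
  have he : Real.exp x ≤ 3 := by
    have h2 := Real.exp_one_lt_d9
    have h3 : Real.exp x ≤ Real.exp 1 := Real.exp_le_exp.2 h1
    linarith
  nlinarith

set_option maxHeartbeats 800000 in -- a dozen explicit numeric estimates; each `nlinarith only` is small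
/-- **The numeric bookkeeping of [CMP]:** in regime R2 at both centres, with `R ≤ 1/20`, `δ ≤ 32`,
`|T − T₀| ≤ R` and the largeness hypothesis `10⁴·N² ≤ δ·T₀`, the product bound of
`norm_arcMainTerm_sub_arcShiftModel_le` is at most `1/100` (in fact each factor is within `4·10⁻³` of `1`).
[folklore] -/
theorem cmp_product_le {N T T₀ ℓ ℓ₀ h h₀ R δ : ℝ} (hN : 100 ≤ N) (hT : 1200 ≤ T)
    (hT₀ : 1200 ≤ T₀) (hℓ : 20 ≤ ℓ) (hℓ₀ : 20 ≤ ℓ₀) (hh : 1 / 2 ≤ h) (hH : h ≤ 20)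
    (hh₀ : 1 / 2 ≤ h₀) (hH₀ : h₀ ≤ 20) (hR0 : 0 ≤ R) (hR : R ≤ 1 / 20) (hδ : 0 < δ)
    (hδ32 : δ ≤ 32) (hlarge : 10 ^ 4 * N ^ 2 ≤ δ * T₀) (hNT : N + 1 ≤ T / 6)
    (hNT₀ : N + 1 ≤ T₀ / 6) (hTT₀ : |T - T₀| ≤ R) :
    (1 + ((33 / 4 / T + 1 / (79 / 100 * T) ^ 2 + (N + 1) / (179 / 100 * T) ^ 2 +
            25 * N / (4 * h ^ 2)) * (110 * N * R / (T₀ * ℓ * ℓ₀)) ^ 2) *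
          Real.exp ((33 / 4 / T + 1 / (79 / 100 * T) ^ 2 + (N + 1) / (179 / 100 * T) ^ 2 +
            25 * N / (4 * h ^ 2)) * (110 * N * R / (T₀ * ℓ * ℓ₀)) ^ 2)) *
        (1 + (110 * N * R / (T₀ * ℓ * ℓ₀)) / δ *
          Real.exp ((110 * N * R / (T₀ * ℓ * ℓ₀)) / δ)) *
        (1 + Real.sqrt 2 * (77 / 10 * (h ^ 2 / T + h₀ ^ 2 / T₀)) / (11 / 40 * N)) - 1 ≤
      1 / 100 := by
  set M : ℝ := 33 / 4 / T + 1 / (79 / 100 * T) ^ 2 + (N + 1) / (179 / 100 * T) ^ 2 +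
    25 * N / (4 * h ^ 2) with hM
  set d : ℝ := 110 * N * R / (T₀ * ℓ * ℓ₀) with hd
  clear_value M d
  have hT0 : 0 < T := by linarith only [hT]
  have hT00 : 0 < T₀ := by linarith only [hT₀]
  have hN0 : 0 < N := by linarith only [hN]
  have hh0 : 0 < h := by linarith only [hh]
  have hh00 : 0 < h₀ := by linarith only [hh₀]
  have hℓpos : 0 < ℓ := by linarith only [hℓ]
  have hℓ0pos : 0 < ℓ₀ := by linarith only [hℓ₀]
  have hTT := abs_le.1 hTT₀
  -- sizes of `T₀`, `T`
  have hN2 : (10000 : ℝ) ≤ N ^ 2 := by nlinarith only [hN]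
  have hδT : δ * T₀ ≤ 32 * T₀ := mul_le_mul_of_nonneg_right hδ32 hT00.le
  have hT₀big : 3125000 ≤ T₀ := by nlinarith only [hlarge, hδT, hN2]
  have hTbig : 3000000 ≤ T := by linarith only [hT₀big, hTT.1, hTT.2, hR]
  have hT2 : 1200 * 1200 ≤ T * T := mul_le_mul hT hT (by norm_num) hT0.le
  -- `d ≤ (11/800) N/T₀`
  have hd0 : 0 ≤ d := by rw [hd]; positivity
  have hdle : d ≤ 11 / 800 * N / T₀ := by
    rw [hd]
    have hnum : 110 * N * R ≤ 11 / 2 * N := by nlinarith only [hR, hN0, hR0]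
    have hℓℓ : (400 : ℝ) ≤ ℓ * ℓ₀ := by nlinarith only [hℓ, hℓ₀]
    have hden : 400 * T₀ ≤ T₀ * ℓ * ℓ₀ := by nlinarith only [hℓℓ, hT00]
    calc 110 * N * R / (T₀ * ℓ * ℓ₀) ≤ (11 / 2 * N) / (400 * T₀) :=
          div_le_div₀ (by positivity) hnum (by positivity) hden
      _ = 11 / 800 * N / T₀ := by field_simp; ring
  -- `ε₂ ≤ 10⁻⁵`
  have hε₂ : d / δ ≤ 1 / 100000 := by
    have h1 : d / δ ≤ (11 / 800 * N / T₀) / δ := div_le_div_of_nonneg_right hdle hδ.le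
    refine h1.trans ?_
    rw [div_div, div_le_div_iff₀ (by positivity) (by norm_num)]
    nlinarith only [hlarge, hN, hN0]
  -- `M ≤ 26 N`
  have hMle : M ≤ 26 * N := by
    have h1 : 33 / 4 / T ≤ 1 / 100 := by rw [div_le_iff₀ hT0]; linarith only [hT]
    have h2 : 1 / (79 / 100 * T) ^ 2 ≤ 1 / 100 := by
      rw [div_le_div_iff₀ (by positivity) (by norm_num)]; nlinarith only [hT2]
    have h3 : (N + 1) / (179 / 100 * T) ^ 2 ≤ 1 / 100 := by
      rw [div_le_div_iff₀ (by positivity) (by norm_num)]; nlinarith only [hNT, hT2, hT]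
    have h4sq : (1 : ℝ) ≤ 4 * h ^ 2 := by nlinarith only [hh]
    have h4 : 25 * N / (4 * h ^ 2) ≤ 25 * N := by
      calc 25 * N / (4 * h ^ 2) ≤ 25 * N / 1 := div_le_div_of_nonneg_left (by positivity) one_pos h4sq
        _ = 25 * N := div_one _
    rw [hM]
    linarith only [h1, h2, h3, h4, hN]
  have hM0 : 0 ≤ M := by rw [hM]; positivity
  -- `ε₁ ≤ 10⁻⁵`
  have hε₁ : M * d ^ 2 ≤ 1 / 100000 := by
    have hd2 : d ^ 2 ≤ (11 / 800 * N / T₀) ^ 2 := pow_le_pow_left₀ hd0 hdle 2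
    have h1 : M * d ^ 2 ≤ 26 * N * (11 / 800 * N / T₀) ^ 2 :=
      mul_le_mul hMle hd2 (sq_nonneg _) (by positivity)
    refine h1.trans ?_
    have hN2' : N ^ 2 ≤ 32 / 10000 * T₀ := by nlinarith only [hlarge, hδT]
    have hN1 : N ≤ T₀ / 6 := by linarith only [hNT₀]
    rw [show 26 * N * (11 / 800 * N / T₀) ^ 2 = 26 * (11 / 800) ^ 2 * (N * N ^ 2) / T₀ ^ 2 by
      field_simp]
    rw [div_le_div_iff₀ (by positivity) (by norm_num)]
    have h3 : N * N ^ 2 ≤ T₀ / 6 * (32 / 10000 * T₀) :=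
      mul_le_mul hN1 hN2' (sq_nonneg _) (by positivity)
    nlinarith only [h3]
  -- `ε₃ ≤ 1/250`
  have hε₃ : Real.sqrt 2 * (77 / 10 * (h ^ 2 / T + h₀ ^ 2 / T₀)) / (11 / 40 * N) ≤ 1 / 250 := by
    have hsqrt : Real.sqrt 2 ≤ 3 / 2 := by
      have e : Real.sqrt ((3 / 2) ^ 2) = 3 / 2 := Real.sqrt_sq (by norm_num)
      calc Real.sqrt 2 ≤ Real.sqrt ((3 / 2) ^ 2) := Real.sqrt_le_sqrt (by norm_num)
        _ = 3 / 2 := e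
    have h1 : h ^ 2 / T ≤ 400 / 3000000 := by
      rw [div_le_div_iff₀ hT0 (by norm_num)]; nlinarith only [hH, hh0, hTbig]
    have h2 : h₀ ^ 2 / T₀ ≤ 400 / 3000000 := by
      rw [div_le_div_iff₀ hT00 (by norm_num)]; nlinarith only [hH₀, hh00, hT₀big]
    have hsum : 77 / 10 * (h ^ 2 / T + h₀ ^ 2 / T₀) ≤ 77 / 10 * (800 / 3000000) := by
      linarith only [h1, h2]
    have hnum : Real.sqrt 2 * (77 / 10 * (h ^ 2 / T + h₀ ^ 2 / T₀)) ≤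
        3 / 2 * (77 / 10 * (800 / 3000000)) :=
      mul_le_mul hsqrt hsum (by positivity) (by norm_num)
    rw [div_le_iff₀ (by positivity)]
    nlinarith only [hnum, hN]
  -- the three factors
  have hA : M * d ^ 2 * Real.exp (M * d ^ 2) ≤ 3 / 100000 := by
    have := mul_exp_le_three_mul (x := M * d ^ 2) (by positivity) (by linarith only [hε₁])
    linarith only [this, hε₁]
  have hB : d / δ * Real.exp (d / δ) ≤ 3 / 100000 := by
    have := mul_exp_le_three_mul (x := d / δ) (by positivity) (by linarith only [hε₂])
    linarith only [this, hε₂]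
  have hB0 : 0 ≤ d / δ * Real.exp (d / δ) := by positivity
  have hC0 : 0 ≤ Real.sqrt 2 * (77 / 10 * (h ^ 2 / T + h₀ ^ 2 / T₀)) / (11 / 40 * N) := by
    positivity
  calc (1 + M * d ^ 2 * Real.exp (M * d ^ 2)) * (1 + d / δ * Real.exp (d / δ)) *
        (1 + Real.sqrt 2 * (77 / 10 * (h ^ 2 / T + h₀ ^ 2 / T₀)) / (11 / 40 * N)) - 1
      ≤ (1 + 3 / 100000) * (1 + 3 / 100000) * (1 + 1 / 250) - 1 := by
        gcongr
    _ ≤ 1 / 100 := by norm_num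

end numeric

section radius

/-- **Band radii at nearby heights.** For `T, T₀ ≥ 100` with `ℓ_T, ℓ_{T₀} ≥ 20` and `|T − T₀| ≤ 1/20`:
`|h(n,T) − h(n,T₀)| ≤ h(n,T)/20` (indeed `≤ h/40000`: `|ℓ_T − ℓ_{T₀}| = |log(T/T₀)| ≤ 1/2000` and
`h − h₀ = h(ℓ_{T₀} − ℓ_T)/ℓ_{T₀}`). [folklore] -/
theorem abs_bandRadius_sub_le {n : ℕ} {T T₀ : ℝ} (hT : 100 ≤ T) (hT₀ : 100 ≤ T₀)
    (hℓ : 20 ≤ ell T) (hℓ₀ : 20 ≤ ell T₀) (hTT₀ : |T - T₀| ≤ 1 / 20) :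
    |bandRadius n T - bandRadius n T₀| ≤ bandRadius n T / 20 := by
  have hT0 : 0 < T := by linarith
  have hT00 : 0 < T₀ := by linarith
  have hℓpos : 0 < ell T := by linarith
  have hℓ0pos : 0 < ell T₀ := by linarith
  have hTT := abs_le.1 hTT₀
  -- `|ℓ_T − ℓ_{T₀}| ≤ 1/2000`
  have hdiff : ell T - ell T₀ = Real.log (T / T₀) := by
    rw [ell, ell, Real.log_div hT0.ne' (by positivity), Real.log_div hT00.ne' (by positivity),
      Real.log_div hT0.ne' hT00.ne']
    ring
  have hup : ell T - ell T₀ ≤ 1 / 2000 := by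
    rw [hdiff]
    have h1 := Real.log_le_sub_one_of_pos (show 0 < T / T₀ by positivity)
    have h2 : T / T₀ - 1 ≤ 1 / 2000 := by
      rw [div_sub_one hT00.ne', div_le_div_iff₀ hT00 (by norm_num)]; linarith
    linarith
  have hdn : ell T₀ - ell T ≤ 1 / 2000 := by
    have hdiff' : ell T₀ - ell T = Real.log (T₀ / T) := by
      rw [ell, ell, Real.log_div hT0.ne' (by positivity), Real.log_div hT00.ne' (by positivity),
        Real.log_div hT00.ne' hT0.ne']
      ring
    rw [hdiff']
    have h1 := Real.log_le_sub_one_of_pos (show 0 < T₀ / T by positivity)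
    have h2 : T₀ / T - 1 ≤ 1 / 2000 := by
      rw [div_sub_one hT0.ne', div_le_div_iff₀ hT0 (by norm_num)]; linarith
    linarith
  have habsℓ : |ell T₀ - ell T| ≤ 1 / 2000 := abs_le.2 ⟨by linarith, hdn⟩
  -- `h − h₀ = h (ℓ₀ − ℓ)/ℓ₀`
  have hkey : bandRadius n T - bandRadius n T₀ = bandRadius n T * ((ell T₀ - ell T) / ell T₀) := by
    rw [bandRadius, bandRadius]
    field_simp
  have hh0 : 0 < bandRadius n T := by rw [bandRadius]; positivity
  rw [hkey, abs_mul, abs_of_pos hh0, abs_div, abs_of_pos hℓ0pos]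
  have hfrac : |ell T₀ - ell T| / ell T₀ ≤ 1 / 20 := by
    rw [div_le_div_iff₀ hℓ0pos (by norm_num)]
    nlinarith
  calc bandRadius n T * (|ell T₀ - ell T| / ell T₀) ≤ bandRadius n T * (1 / 20) :=
        mul_le_mul_of_nonneg_left hfrac hh0.le
    _ = bandRadius n T / 20 := by ring

end radius

section compareNumeric

variable {n : ℕ} {x₀ T₀ x T R : ℝ} {u₀ u : ℂ}

/-- **[CMP] (numeric form).** Under the hypotheses of `norm_arcMainTerm_sub_arcShiftModel_le` (the
radius closeness `|h − h₀| ≤ h/20` being automatic from `‖c − c₀‖ ≤ R ≤ 1/20`, `abs_bandRadius_sub_le`)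
and the largeness hypothesis `10⁴·n² ≤ δ·T₀`:
`‖Main(c,u*) − M̃_{c₀,u₀}(c)‖ ≤ (1/100)·‖M̃_{c₀,u₀}(c)‖` — the `ε‖M‖` input of the log-derivative
transfer `LogBand.LogDerivTransfer.re_logDeriv_ge_of_norm_sub_le` for the model comparison part.
RH-FREE. [folklore] -/
theorem norm_arcMainTerm_sub_arcShiftModel_le_of_large (hx₀ : |x₀| ≤ 1 / 2) (hT₀ : 100 ≤ T₀)
    (hℓ₀ : 20 ≤ ell T₀) (hn : 100 ≤ n) (hh₀ : 1 / 2 ≤ bandRadius n T₀)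
    (hh₀T : bandRadius n T₀ ≤ 7 / 20 * T₀) (hH₀ : bandRadius n T₀ ≤ 20)
    (hu₀ : ‖u₀ - ((x₀ : ℂ) + (T₀ : ℂ) * I + bandRadius n T₀)‖ ≤ 3 / 5 * bandRadius n T₀)
    (hS₀ : arcSaddleFn n ((x₀ : ℂ) + (T₀ : ℂ) * I) u₀ = 0)
    (hx : |x| ≤ 1 / 2) (hT : 100 ≤ T) (hℓ : 20 ≤ ell T) (hh : 1 / 2 ≤ bandRadius n T)
    (hhT : bandRadius n T ≤ 7 / 20 * T) (hH : bandRadius n T ≤ 20)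
    (hu : ‖u - ((x : ℂ) + (T : ℂ) * I + bandRadius n T)‖ ≤ 3 / 5 * bandRadius n T)
    (hS : arcSaddleFn n ((x : ℂ) + (T : ℂ) * I) u = 0)
    (hR : R ≤ 1 / 20) (hcc : ‖((x : ℂ) + (T : ℂ) * I) - ((x₀ : ℂ) + (T₀ : ℂ) * I)‖ ≤ R)
    {δ : ℝ} (hδ : 0 < δ) (hδσ : 1 + δ + 2 * R ≤ (1 / 2 + u₀).re)
    (hlarge : (10 : ℝ) ^ 4 * (n : ℝ) ^ 2 ≤ δ * T₀) :
    ‖arcMainTerm n ((x : ℂ) + (T : ℂ) * I) u -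
        arcShiftModel n ((x₀ : ℂ) + (T₀ : ℂ) * I) u₀ ((x : ℂ) + (T : ℂ) * I)‖ ≤
      1 / 100 * ‖arcShiftModel n ((x₀ : ℂ) + (T₀ : ℂ) * I) u₀ ((x : ℂ) + (T : ℂ) * I)‖ := by
  have hTT₀ : |T - T₀| ≤ R := by
    have := (Complex.abs_im_le_norm (((x : ℂ) + (T : ℂ) * I) - ((x₀ : ℂ) + (T₀ : ℂ) * I))).trans hcc
    simpa using this
  have hhh : |bandRadius n T - bandRadius n T₀| ≤ bandRadius n T / 20 :=
    abs_bandRadius_sub_le hT hT₀ hℓ hℓ₀ (hTT₀.trans hR)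
  have hmain := norm_arcMainTerm_sub_arcShiftModel_le hx₀ hT₀ hℓ₀ hn hh₀ hh₀T hH₀ hu₀ hS₀ hx hT hℓ hh
    hhT hH hu hS hR hcc hhh hδ hδσ
  obtain ⟨-, -, -, hT1200₀, hnT₀⟩ := R2_bookkeeping hT₀ hℓ₀ hh₀ hH₀
  obtain ⟨-, -, -, hT1200, hnT⟩ := R2_bookkeeping hT hℓ hh hH
  obtain ⟨-, -, -, hre_hi, -⟩ := disc_geometry hx₀ hT₀ hh₀ hh₀T hu₀
  have hR0 : 0 ≤ R := (norm_nonneg _).trans hcc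
  have hδ32 : δ ≤ 32 := by linarith
  have hN : (100 : ℝ) ≤ n := by exact_mod_cast hn
  have key := cmp_product_le hN hT1200 hT1200₀ hℓ hℓ₀ hh hH hh₀ hH₀ hR0 hR hδ hδ32 hlarge hnT hnT₀ hTT₀
  exact hmain.trans (mul_le_mul_of_nonneg_right key (norm_nonneg _))

end compareNumeric

end Summit.RiemannHypothesis.RiemannHypothesis.Theorems.JensenPolynomials.LogBandArc

end
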